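import Summits.KontsevichZagierPeriods.KontsevichZagierPeriods.Theorems.HeckeMultiplicityOneMultiplicityOneAlgebra

/-!
# `ModularSectorCommensurability` (stmt-KontsevichZagierPeriods-5195, route `HeckeMultiplicityOne`) — algebraic preparations

Helper file for the (still informal) support item stmt-KontsevichZagierPeriods-5195
`ModularSectorCommensurability` of route `KontsevichZagierPeriods/HeckeMultiplicityOne`: "any two
modular-symbol representations (real parts, resp. imaginary parts) of one rational newform are
`ℤ`-commensurable modulo the moves of the Kontsevich–Zagier calculus".  Its proof plan (route file,
item text) is: `HeckeIsMoves` + `ManinStokes` make the class map `Λ : ℤ[Manin symbols] → FormalRep`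
Hecke-equivariant modulo `KZ.relations` and compatible with Manin's presentation, and the landed
support `MultiplicityOneAlgebra` (`commensurable_of_eigenDual`, pure linear algebra) then forces
commensurability from multiplicity one.

`MultiplicityOneAlgebra` is stated for matrices on `ℤ^k = Fin k → ℤ`; the Manin symbols of level `N`
are indexed by the finite type `SL(2, ℤ) ⧸ Γ₀(N)` (`Gamma0Coset N` of `ModularSymbolsManin`).  This
file transports the theorem to an arbitrary finite index type (`commensurable_of_eigenDual_fintype`)
and folds Manin's presentation and the real involution into the multiplicity-one family
(`commensurable_of_perm_relations`): given permutations `s` (two-term relation `y ↦ yS`), `t`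
(three-term relation `y ↦ yTS`) and `r` (the real involution) of the index set with the generator
relations `Λ e_y + Λ e_{s y} ∈ R`, `Λ e_y + Λ e_{t y} + Λ e_{t² y} ∈ R`, `Λ e_{r y} - ε Λ e_y ∈ R`, and
Hecke matrices `H_j` with `Λ (H_j m) - a_j Λ m ∈ R`, multiplicity one in the form "any two rational
vectors killing the relations, of parity `ε`, and joint row-eigenvectors of the `H_j` are
proportional" gives `ℤ`-commensurability of any two images — the form in which the sector theorem
(`HeckeMultiplicityOneModularSectorCommensurabilitySymbols`) consumes it.

References: B. Mazur, P. Swinnerton-Dyer, *Arithmetic of Weil curves*, Invent. Math. 25 (1974), §2;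
Ju. I. Manin, *Parabolic points and zeta functions of modular curves* (1972), §1;
J. E. Cremona, *Algorithms for modular elliptic curves* (1997), Ch. II.
-/

namespace Summit.KontsevichZagierPeriods.HeckeMultiplicityOne.ModularSectorCommensurability

open Summit.KontsevichZagierPeriods.HeckeMultiplicityOne.MultiplicityOneAlgebra

/-- **Commensurability from multiplicity one, matrices indexed by a finite type.** The theorem
`MultiplicityOneAlgebra.commensurable_of_eigenDual` (integer matrices `T j` on `ℤ^k` with integer
"eigenvalues" `a j`, an additive `Λ : ℤ^k →+ G` equivariant modulo `R`, joint rational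
row-eigenspace of dimension `≤ 1` ⟹ any two integer vectors have `ℤ`-commensurable images modulo
`R`) transported from `Fin k` to an arbitrary finite index type `X` (the finite set of Manin
symbols `Γ₀(N)\SL₂(ℤ) ≅ ℙ¹(ℤ/Nℤ)` in the application) along `Fintype.equivFin`. [folklore] -/
theorem commensurable_of_eigenDual_fintype {G : Type*} [AddCommGroup G] (R : AddSubgroup G)
    {X : Type*} [Fintype X] [DecidableEq X] {J : Type*} (T : J → Matrix X X ℤ) (a : J → ℤ)
    (Λ : (X → ℤ) →+ G)
    (hΛ : ∀ (j : J) (m : X → ℤ), Λ ((T j).mulVec m) - a j • Λ m ∈ R)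
    (hdim : ∀ φ ψ : X → ℚ,
      (∀ j, Matrix.vecMul φ ((T j).map (Int.cast : ℤ → ℚ)) = (a j : ℚ) • φ) →
      (∀ j, Matrix.vecMul ψ ((T j).map (Int.cast : ℤ → ℚ)) = (a j : ℚ) • ψ) →
      ∃ u v : ℚ, (u ≠ 0 ∨ v ≠ 0) ∧ u • φ = v • ψ)
    (m m' : X → ℤ) :
    ∃ c c' : ℤ, (c ≠ 0 ∨ c' ≠ 0) ∧ c • Λ m - c' • Λ m' ∈ R := by
  classical
  set k := Fintype.card X
  let e : X ≃ Fin k := Fintype.equivFin X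
  -- the reindexed data on `Fin k`
  let T' : J → Matrix (Fin k) (Fin k) ℤ := fun j => (T j).submatrix e.symm e.symm
  let Λ' : (Fin k → ℤ) →+ G := Λ.comp (LinearMap.funLeft ℤ ℤ e).toAddMonoidHom
  have hΛ'apply : ∀ v : Fin k → ℤ, Λ' v = Λ (v ∘ e) := fun v => rfl
  have hT'mul : ∀ (j : J) (v : Fin k → ℤ), (T' j).mulVec v = ((T j).mulVec (v ∘ e)) ∘ e.symm :=
    fun j v => Matrix.submatrix_mulVec_equiv (T j) v e.symm e.symm
  have hΛ' : ∀ (j : J) (v : Fin k → ℤ), Λ' ((T' j).mulVec v) - a j • Λ' v ∈ R := by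
    intro j v
    rw [hΛ'apply, hΛ'apply, hT'mul]
    have hcomp : (((T j).mulVec (v ∘ e)) ∘ e.symm) ∘ e = (T j).mulVec (v ∘ e) := by
      funext x; simp
    rw [hcomp]
    exact hΛ j (v ∘ e)
  have hvec : ∀ (χ' : Fin k → ℚ) (j : J),
      Matrix.vecMul χ' ((T' j).map (Int.cast : ℤ → ℚ)) =
        (Matrix.vecMul (χ' ∘ e) ((T j).map (Int.cast : ℤ → ℚ))) ∘ e.symm := fun χ' j =>
    Matrix.submatrix_vecMul_equiv ((T j).map (Int.cast : ℤ → ℚ)) χ' e.symm e.symm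
  have hdim' : ∀ φ' ψ' : Fin k → ℚ,
      (∀ j, Matrix.vecMul φ' ((T' j).map (Int.cast : ℤ → ℚ)) = (a j : ℚ) • φ') →
      (∀ j, Matrix.vecMul ψ' ((T' j).map (Int.cast : ℤ → ℚ)) = (a j : ℚ) • ψ') →
      ∃ u v : ℚ, (u ≠ 0 ∨ v ≠ 0) ∧ u • φ' = v • ψ' := by
    intro φ' ψ' hφ' hψ'
    have key : ∀ χ' : Fin k → ℚ,
        (∀ j, Matrix.vecMul χ' ((T' j).map (Int.cast : ℤ → ℚ)) = (a j : ℚ) • χ') →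
        ∀ j, Matrix.vecMul (χ' ∘ e) ((T j).map (Int.cast : ℤ → ℚ)) = (a j : ℚ) • (χ' ∘ e) := by
      intro χ' h j
      funext x
      have h1 := congr_fun (h j) (e x)
      rw [hvec] at h1
      simpa using h1
    obtain ⟨u, v, huv, heq⟩ := hdim _ _ (key φ' hφ') (key ψ' hψ')
    refine ⟨u, v, huv, ?_⟩
    funext i
    have h2 := congr_fun heq (e.symm i)
    simpa using h2
  obtain ⟨c, c', hcc', hmem⟩ :=
    commensurable_of_eigenDual R T' a Λ' hΛ' hdim' (m ∘ e.symm) (m' ∘ e.symm)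
  refine ⟨c, c', hcc', ?_⟩
  have hm : Λ' (m ∘ e.symm) = Λ m := by
    rw [hΛ'apply]; congr 1; funext x; simp
  have hm' : Λ' (m' ∘ e.symm) = Λ m' := by
    rw [hΛ'apply]; congr 1; funext x; simp
  rwa [hm, hm'] at hmem

/-- **Folding Manin's presentation and the real involution into the multiplicity-one family.**
Abstract form of the glue of the sector theorem.  Let `Λ : ℤ^X →+ G` (in the application: `X` the
Manin symbols of level `N`, `Λ` the class map into `KZ.FormalRep`, `R = KZ.relations`), and suppose,
modulo `R`:
* (two-term relation) `Λ e_y + Λ e_{s y} ∈ R` for a permutation `s` of `X` (`y ↦ yS`);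
* (three-term relation — `ManinStokes`) `Λ e_y + Λ e_{t y} + Λ e_{t² y} ∈ R` (`y ↦ yTS`);
* (real involution) `Λ e_{r y} - ε Λ e_y ∈ R` for a permutation `r` (`y ↦ ỹ`) and a sign `ε`;
* (Hecke — `HeckeIsMoves`) `Λ (H_j m) - a_j Λ m ∈ R` for integer matrices `H_j` with integer
  eigenvalues `a_j`;
* (multiplicity one) any two rational vectors `φ` on `X` which kill the two- and three-term
  relations, satisfy `φ (r y) = ε φ y`, and are joint row-eigenvectors of the `H_j` (`φ H_j = a_j φ`)
  are `ℚ`-proportional.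
Then any two integer vectors have `ℤ`-commensurable images: `(c, c') ≠ (0, 0)` with
`c Λ m - c' Λ m' ∈ R`.  Proof: enlarge the family `(H_j, a_j)` by `(1 + P_{s⁻¹}, 0)`,
`(1 + P_{t⁻¹} + P_{t⁻²}, 0)`, `(P_{r⁻¹}, ε)` (`P_π` the permutation matrix, `P_π m = m ∘ π`); the
three generator hypotheses give the equivariance of `Λ` for the new members by additivity, the
row-eigenvector conditions for them are exactly the three conditions on `φ`, and
`commensurable_of_eigenDual_fintype` applies. [folklore] -/
theorem commensurable_of_perm_relations {G : Type*} [AddCommGroup G] (R : AddSubgroup G)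
    {X : Type*} [Fintype X] [DecidableEq X] {J : Type*} (H : J → Matrix X X ℤ) (a : J → ℤ)
    (s t r : Equiv.Perm X) (ε : ℤ) (Λ : (X → ℤ) →+ G)
    (h2 : ∀ y, Λ (Pi.single y 1) + Λ (Pi.single (s y) 1) ∈ R)
    (h3 : ∀ y, Λ (Pi.single y 1) + Λ (Pi.single (t y) 1) + Λ (Pi.single (t (t y)) 1) ∈ R)
    (hr : ∀ y, Λ (Pi.single (r y) 1) - ε • Λ (Pi.single y 1) ∈ R)
    (hH : ∀ (j : J) (m : X → ℤ), Λ ((H j).mulVec m) - a j • Λ m ∈ R)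
    (hdim : ∀ φ ψ : X → ℚ,
      ((∀ y, φ y + φ (s y) = 0) ∧ (∀ y, φ y + φ (t y) + φ (t (t y)) = 0) ∧
        (∀ y, φ (r y) = ε * φ y) ∧
        ∀ j, Matrix.vecMul φ ((H j).map (Int.cast : ℤ → ℚ)) = (a j : ℚ) • φ) →
      ((∀ y, ψ y + ψ (s y) = 0) ∧ (∀ y, ψ y + ψ (t y) + ψ (t (t y)) = 0) ∧
        (∀ y, ψ (r y) = ε * ψ y) ∧
        ∀ j, Matrix.vecMul ψ ((H j).map (Int.cast : ℤ → ℚ)) = (a j : ℚ) • ψ) →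
      ∃ u v : ℚ, (u ≠ 0 ∨ v ≠ 0) ∧ u • φ = v • ψ)
    (m m' : X → ℤ) :
    ∃ c c' : ℤ, (c ≠ 0 ∨ c' ≠ 0) ∧ c • Λ m - c' • Λ m' ∈ R := by
  classical
  -- every integer vector is the integral combination of the basis vectors `e y = Pi.single y 1`
  have hexp : ∀ v : X → ℤ, v = ∑ y, v y • (Pi.single y (1 : ℤ) : X → ℤ) := by
    intro v
    funext x
    simp only [Finset.sum_apply, Pi.smul_apply, Pi.single_apply, smul_eq_mul, mul_ite, mul_one,
      mul_zero]
    rw [Finset.sum_ite_eq]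
    simp
  have hΛexp : ∀ v : X → ℤ, Λ v = ∑ y, v y • Λ (Pi.single y 1) := by
    intro v
    conv_lhs => rw [hexp v]
    rw [map_sum]
    exact Finset.sum_congr rfl fun y _ => map_zsmul Λ _ _
  have hΛperm : ∀ (π : Equiv.Perm X) (v : X → ℤ),
      Λ (v ∘ π) = ∑ y, v y • Λ (Pi.single (π.symm y) 1) := by
    intro π v
    rw [hΛexp, ← Equiv.sum_comp π.symm]
    simp only [Function.comp_apply, Equiv.apply_symm_apply]
  -- permutation matrices
  have hPmul : ∀ (π : Equiv.Perm X) (v : X → ℤ), (Equiv.Perm.permMatrix ℤ π).mulVec v = v ∘ π :=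
    fun π v => Matrix.permMatrix_mulVec π
  have hPmap : ∀ π : Equiv.Perm X,
      (Equiv.Perm.permMatrix ℤ π).map (Int.cast : ℤ → ℚ) = Equiv.Perm.permMatrix ℚ π :=
    fun π => PEquiv.map_toMatrix (Int.castRingHom ℚ) π.toPEquiv
  have hPvec : ∀ (π : Equiv.Perm X) (χ : X → ℚ),
      Matrix.vecMul χ (Equiv.Perm.permMatrix ℚ π) = χ ∘ π.symm :=
    fun π χ => Matrix.vecMul_permMatrix π
  have hmap1 : ((1 : Matrix X X ℤ).map (Int.cast : ℤ → ℚ)) = 1 :=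
    Matrix.map_one _ Int.cast_zero Int.cast_one
  have hmapadd : ∀ M M' : Matrix X X ℤ,
      (M + M').map (Int.cast : ℤ → ℚ) = M.map (Int.cast : ℤ → ℚ) + M'.map (Int.cast : ℤ → ℚ) :=
    fun M M' => Matrix.map_add _ Int.cast_add _ _
  have hsymm : ∀ π : Equiv.Perm X, (π⁻¹).symm = π := fun π => by
    rw [Equiv.Perm.inv_def, Equiv.symm_symm]
  -- the enlarged family
  let T' : J ⊕ Fin 3 → Matrix X X ℤ := Sum.elim H
    ![1 + Equiv.Perm.permMatrix ℤ s⁻¹,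
      1 + Equiv.Perm.permMatrix ℤ t⁻¹ + Equiv.Perm.permMatrix ℤ (t⁻¹ * t⁻¹),
      Equiv.Perm.permMatrix ℤ r⁻¹]
  let a' : J ⊕ Fin 3 → ℤ := Sum.elim a ![0, 0, ε]
  have hT'0 : T' (Sum.inr 0) = 1 + Equiv.Perm.permMatrix ℤ s⁻¹ := rfl
  have hT'1 : T' (Sum.inr 1) =
      1 + Equiv.Perm.permMatrix ℤ t⁻¹ + Equiv.Perm.permMatrix ℤ (t⁻¹ * t⁻¹) := rfl
  have hT'2 : T' (Sum.inr 2) = Equiv.Perm.permMatrix ℤ r⁻¹ := rfl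
  have ha'0 : a' (Sum.inr 0) = 0 := rfl
  have ha'1 : a' (Sum.inr 1) = 0 := rfl
  have ha'2 : a' (Sum.inr 2) = ε := rfl
  have htt : ∀ y, (t⁻¹ * t⁻¹).symm y = t (t y) := fun y => by
    rw [show (t⁻¹ * t⁻¹).symm = (t⁻¹ * t⁻¹)⁻¹ from (Equiv.Perm.inv_def _).symm, mul_inv_rev, inv_inv,
      Equiv.Perm.mul_apply]
  -- equivariance of `Λ` for the enlarged family
  have hΛ' : ∀ (i : J ⊕ Fin 3) (v : X → ℤ), Λ ((T' i).mulVec v) - a' i • Λ v ∈ R := by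
    rintro (j | i) v
    · exact hH j v
    · fin_cases i
      · show Λ ((T' (Sum.inr 0)).mulVec v) - a' (Sum.inr 0) • Λ v ∈ R
        rw [hT'0, ha'0, zero_smul, sub_zero, Matrix.add_mulVec, Matrix.one_mulVec, hPmul, map_add,
          hΛperm, hsymm, hΛexp v, ← Finset.sum_add_distrib]
        refine R.sum_mem fun y _ => ?_
        rw [← smul_add]
        exact R.zsmul_mem (h2 y) _
      · show Λ ((T' (Sum.inr 1)).mulVec v) - a' (Sum.inr 1) • Λ v ∈ R
        rw [hT'1, ha'1, zero_smul, sub_zero, Matrix.add_mulVec, Matrix.add_mulVec, Matrix.one_mulVec,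
          hPmul, hPmul, map_add, map_add, hΛperm, hΛperm, hsymm, hΛexp v, ← Finset.sum_add_distrib,
          ← Finset.sum_add_distrib]
        refine R.sum_mem fun y _ => ?_
        rw [htt, ← smul_add, ← smul_add]
        exact R.zsmul_mem (h3 y) _
      · show Λ ((T' (Sum.inr 2)).mulVec v) - a' (Sum.inr 2) • Λ v ∈ R
        rw [hT'2, ha'2, hPmul, hΛperm, hsymm, hΛexp v, Finset.smul_sum, ← Finset.sum_sub_distrib]
        refine R.sum_mem fun y _ => ?_
        rw [smul_comm, ← smul_sub]
        exact R.zsmul_mem (hr y) _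
  -- the row-eigenvector conditions for the enlarged family
  have hrow : ∀ χ : X → ℚ,
      (∀ i, Matrix.vecMul χ ((T' i).map (Int.cast : ℤ → ℚ)) = (a' i : ℚ) • χ) →
      (∀ y, χ y + χ (s y) = 0) ∧ (∀ y, χ y + χ (t y) + χ (t (t y)) = 0) ∧
        (∀ y, χ (r y) = ε * χ y) ∧
        ∀ j, Matrix.vecMul χ ((H j).map (Int.cast : ℤ → ℚ)) = (a j : ℚ) • χ := by
    intro χ hχ
    refine ⟨fun y => ?_, fun y => ?_, fun y => ?_, fun j => hχ (Sum.inl j)⟩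
    · have h := congr_fun (hχ (Sum.inr 0)) y
      rw [hT'0, ha'0, hmapadd, hmap1, hPmap, Matrix.vecMul_add, Matrix.vecMul_one, hPvec, hsymm]
        at h
      simpa using h
    · have h := congr_fun (hχ (Sum.inr 1)) y
      rw [hT'1, ha'1, hmapadd, hmapadd, hmap1, hPmap, hPmap, Matrix.vecMul_add, Matrix.vecMul_add,
        Matrix.vecMul_one, hPvec, hPvec, hsymm] at h
      simpa [htt] using h
    · have h := congr_fun (hχ (Sum.inr 2)) y
      rw [hT'2, ha'2, hPmap, hPvec, hsymm] at h
      simpa using h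
  have hdim' : ∀ φ ψ : X → ℚ,
      (∀ i, Matrix.vecMul φ ((T' i).map (Int.cast : ℤ → ℚ)) = (a' i : ℚ) • φ) →
      (∀ i, Matrix.vecMul ψ ((T' i).map (Int.cast : ℤ → ℚ)) = (a' i : ℚ) • ψ) →
      ∃ u v : ℚ, (u ≠ 0 ∨ v ≠ 0) ∧ u • φ = v • ψ :=
    fun φ ψ hφ hψ => hdim φ ψ (hrow φ hφ) (hrow ψ hψ)
  exact commensurable_of_eigenDual_fintype R T' a' Λ hΛ' hdim' m m'

end Summit.KontsevichZagierPeriods.HeckeMultiplicityOne.ModularSectorCommensurability
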